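import Summits.AtomisticToContinuum.HydrodynamicLimit.Theorems.StiffCollisionalRelaxationAprioriBoundsFibreDefs
import Summits.AtomisticToContinuum.HydrodynamicLimit.Theorems.OneFlightGossipEngineEnergyCurrentTailsLevelCensusStatics
import HarnessLib

/-!
# Exponential moment of the kinetic energy under the local Gibbs laws
# (stub `stub_energyMoment` of the line `fibre-deficit-transfer`, crux `AprioriBounds`,
# stmt-AtomisticToContinuum-14827)

Registered stub 4 of the skeleton of the line (vocabulary in
`…Theorems.StiffCollisionalRelaxationAprioriBoundsFibreDefs`): for nice profiles `(a₀, θ₀, u₀)`,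
`0 < σ ≤ 1/2` and any flow family `Φ`, `EnergyMomentAt σ a₀ θ₀ u₀ Φ`, i.e. there is `κ > 0` with

  `E_{μ₀} e^{κ E(z)} ≤ e^{(N+1)/κ}` for every `N`,

where `E(z) = ½ ∑ᵢ ‖vᵢ‖²` (`configEnergy`) and `μ₀ = localGibbsLaw σ a₀ u₀ θ₀ N (Φ N)`.

**Proof.**  Given the positions the local Gibbs velocities are independent Gaussians
`N(u₀(xᵢ), θ₀(xᵢ) id)`; the landed tool
`EnergyCurrentTailsLevelCensus.exists_expMoment_localGibbsLaw` (Fernique + disintegration) gives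
`α₀ > 0` and `K ≥ 1` with `E_{μ₀} ∏ᵢ e^{α₀‖vᵢ‖²} ≤ K^{N+1}` for all `σ ≤ 1/2`, `N`, `Φ`.  With
`κ = min (2α₀) (1/(1 + log K))` one has pointwise `e^{κ E(z)} = ∏ᵢ e^{(κ/2)‖vᵢ‖²} ≤ ∏ᵢ e^{α₀‖vᵢ‖²}`
(`κ/2 ≤ α₀`), and `K^{N+1} ≤ e^{(N+1)/κ}` because `log K ≤ 1/κ` (`κ (1 + log K) ≤ 1`).

References: Spohn 1991 Part I §2.3 (local equilibrium states); Fernique 1970 (Gaussian vectors).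
-/

noncomputable section

open MeasureTheory Filter Set Topology
open scoped ENNReal

namespace Summit.AtomisticToContinuum.HydrodynamicLimit.Theorems.FibreDeficitTransfer

open Literature.MathematicalPhysics.KineticTheory Literature.Analysis.FluidPDE
open Summit.AtomisticToContinuum.HydrodynamicLimit.Theorems.AprioriBoundsNegative (PartOneAt PartTwoAt)
open Summit.AtomisticToContinuum.HydrodynamicLimit.Theorems.VisitLedgerUpscattering (Cfg Flow Flows NiceProfiles)
open Summit.AtomisticToContinuum.HydrodynamicLimit.Theorems.EnergyCurrentTailsLevelCensus
  (exists_expMoment_localGibbsLaw)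

/-! ## Two elementary inequalities -/

/-- Pointwise domination of the energy exponential by the product of one-body Gaussian factors:
`e^{κ E(z)} ≤ ∏ᵢ e^{α‖vᵢ‖²}` in `ℝ≥0∞` as soon as `κ ≤ 2α` (`E(z) = ½ ∑ᵢ ‖vᵢ‖²`). [folklore] -/
theorem ofReal_exp_mul_configEnergy_le {N : ℕ} {κ α : ℝ} (hκα : κ ≤ 2 * α) (z : Cfg N) :
    ENNReal.ofReal (Real.exp (κ * configEnergy z)) ≤
      ∏ i : Fin (N + 1), ENNReal.ofReal (Real.exp (α * ‖(z i).2‖ ^ 2)) := by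
  rw [← ENNReal.ofReal_prod_of_nonneg fun i _ => (Real.exp_pos _).le, ← Real.exp_sum]
  refine ENNReal.ofReal_le_ofReal (Real.exp_le_exp.2 ?_)
  rw [configEnergy, ← mul_assoc, Finset.mul_sum]
  exact Finset.sum_le_sum fun i _ => mul_le_mul_of_nonneg_right (by linarith) (sq_nonneg _)

/-- `K^{N+1} ≤ e^{(N+1)/κ}` for `0 ≤ K ≤ e^{1/κ}`. [folklore] -/
theorem pow_succ_le_exp_div {K κ : ℝ} (hK : 0 ≤ K) (hKκ : K ≤ Real.exp (1 / κ)) (N : ℕ) :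
    K ^ (N + 1) ≤ Real.exp (((N : ℝ) + 1) / κ) := by
  calc K ^ (N + 1) ≤ Real.exp (1 / κ) ^ (N + 1) := pow_le_pow_left₀ hK hKκ _
    _ = Real.exp (((N : ℝ) + 1) / κ) := by
        rw [← Real.exp_nat_mul]
        congr 1
        push_cast
        ring

/-! ## The registered stub -/

/-- **Registered stub `stub_energyMoment` (line `fibre-deficit-transfer`).**  For nice profiles,
`0 < σ ≤ 1/2` and any flow family, the local Gibbs laws have an exponential moment of the kinetic
energy: `∃ κ > 0, ∀ N, E_{μ₀} e^{κ E} ≤ e^{(N+1)/κ}` (`EnergyMomentAt`).  Given the positions the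
velocities are independent Gaussians `N(u₀(xᵢ), θ₀(xᵢ) id)`; with the rate `α₀` and constant `K ≥ 1`
of `exists_expMoment_localGibbsLaw` take `κ = min (2α₀) (1/(1 + log K))`. [folklore] -/
theorem stub_energyMoment : ∀ (σ : ℝ) (a₀ θ₀ : T3 → ℝ) (u₀ : T3 → V3) (Φ : (N : ℕ) → HardSphereFlow (Torus.geometry (Fin 3)) (hsDiameter σ N) (N + 1)), 0 < σ → σ ≤ 1 / 2 → NiceProfiles a₀ θ₀ u₀ → EnergyMomentAt σ a₀ θ₀ u₀ Φ := by
  intro σ a₀ θ₀ u₀ Φ _hσ hσ2 hP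
  obtain ⟨ha, hθ, hu, ha0, hθ0⟩ := hP
  obtain ⟨α₀, hα₀, K, hK1, hmom⟩ := exists_expMoment_localGibbsLaw ha hθ hu ha0 hθ0
  have hK0 : 0 ≤ K := zero_le_one.trans hK1
  have hlog : 0 ≤ Real.log K := Real.log_nonneg hK1
  have hden : 0 < 1 + Real.log K := by positivity
  set κ : ℝ := min (2 * α₀) (1 / (1 + Real.log K)) with hκ
  have hκpos : 0 < κ := lt_min (by positivity) (by positivity)
  have hκα : κ ≤ 2 * α₀ := min_le_left _ _
  have hκlog : Real.log K ≤ 1 / κ := by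
    have h1 : κ ≤ 1 / (1 + Real.log K) := min_le_right _ _
    rw [le_div_iff₀ hden] at h1
    rw [le_div_iff₀ hκpos]
    nlinarith
  have hKexp : K ≤ Real.exp (1 / κ) :=
    (Real.log_le_iff_le_exp (zero_lt_one.trans_le hK1)).1 hκlog
  refine ⟨κ, hκpos, fun N => ?_⟩
  obtain ⟨-, hprod⟩ := hmom σ hσ2 N (Φ N)
  calc ∫⁻ z, ENNReal.ofReal (Real.exp (κ * configEnergy z)) ∂(localGibbsLaw σ a₀ u₀ θ₀ N (Φ N))
      ≤ ∫⁻ z, ∏ i : Fin (N + 1), ENNReal.ofReal (Real.exp (α₀ * ‖(z i).2‖ ^ 2))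
          ∂(localGibbsLaw σ a₀ u₀ θ₀ N (Φ N)) :=
        lintegral_mono fun z => ofReal_exp_mul_configEnergy_le hκα z
    _ ≤ ENNReal.ofReal (K ^ (N + 1)) := hprod
    _ ≤ ENNReal.ofReal (Real.exp (((N : ℝ) + 1) / κ)) :=
        ENNReal.ofReal_le_ofReal (pow_succ_le_exp_div hK0 hKexp N)

end Summit.AtomisticToContinuum.HydrodynamicLimit.Theorems.FibreDeficitTransfer

end
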